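import Summits.ValiantsHypothesis.ValiantsHypothesis.Theorems.DepthWindowTreeBiasBridge
import Literature.Computability.AlgebraicComplexity.GenWordAutomaton
import HarnessLib.Audit.Tags

/-!
# Route `DepthWindow` — node bias, low-bias trees, and `ULB ⇒ ¬ TreeBiasGrowth`

Cone-free helper (decomp-valiant lens 4 «depth-reduction / chasm axis», g13) supporting the crux item
`HomImmHardTwoOne` (stmt-ValiantsHypothesis-30635).  After g12 the only typed road into the A-cell
`Hard(2)` is the tree-bias bridge `treeBiasBridge : HomUnroll → SmlizeFormulaDepth → TreeBiasImmFormula →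
TreeBiasGrowth → HomImmHardAll` (`DepthWindowTreeBiasBridge.lean`), whose one open problem-side input is the
word-combinatorial statement `TreeBiasGrowth`.  This file types the BUILDER's side of that statement
(LST 2022, full version, §6: node bias and Prop. 17) and the barrier form of the door:

* `nodeBias` (Def. 15) and the two halves of Prop. 17 in the encoding of `DepthWindowTreeBiasBridge`
  (`nodeBias_le_offCost`, `offCost_le_sum_nodeBias`); hence `treeBiasGe_of_nodeBias` (large node bias in
  every tree forces large tree bias) and `not_treeBiasGe_of_lowBiasTree` (ONE depth-`Δ` tree all of whose
  nodes have bias `≤ β` caps the depth-`Δ` tree bias by `Δ·β`);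
* `LowBiasTree w Δ β` and the conjecture family `UniversalLowBiasAt C` («`ULB_C`»: every integer multiset
  whose letters and total lie in `[-h, h]` has a depth-`(C·⌊log₂⌊log₂ d⌋⌋ + O(1))` tree of node bias `O(h)`);
* the slope-indexed growth statement `TreeBiasGrowthAt a` (`TreeBiasGrowth ↔ ∀ a, TreeBiasGrowthAt a`,
  antitone in `a`) and the kernel implications `UniversalLowBiasAt C → C ≤ a → ¬ TreeBiasGrowthAt a` and
  `UniversalLowBias → ¬ TreeBiasGrowth`.

Companions: `DepthWindowNodeBiasRung.lean` (the binary interval tree is a `LowBiasTree` of node bias `4h` at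
depth `⌈log₂ d⌉` — the trivial end of the depth ladder) and `DepthWindowTreeBiasBridgeAt.lean` (the bridge
slope by slope: the `(2,1)` cell consumes exactly `TreeBiasGrowthAt (2u)`, `u` the unrolling constant, so
`ULB_2` closes the tree-bias door).

Status in print.  Two-letter words: BDS 2024 Thm. 1.7 (`P_Δ`, read through LST 2022 Thm. 3) gives trees of
node bias `O(γ·d^{μ(Δ)})`, `μ(Δ) = 1/(F(Δ)-1)` with `F` Fibonacci, i.e. `O(1)` from depth
`(1/log₂ φ + o(1))·log₂log₂ d ≈ 1.44·log₂log₂ d` on, and BDS Thm. 1.4 shows this is sharp for two letters (so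
`ULB_1` is expected to FAIL on the golden-ratio words); for general `W` the best builder in print is LST 2022
Thm. 27 (node bias `C_Δ·d^{1/Γ(Δ)}`, `Γ(Δ) = Δ^{log Δ/10}`, `C_Δ = 2^{ΔΓ(Δ)+1}`), which is never `O(1)`.
`ULB_2` is OPEN; the workshop node NODE-v13 (lens 4, g13) conjectures it from a mass-recursion heuristic
(one-parameter structured letter families progress at the Fibonacci rate of their continued fraction, spread
families cancel by pigeonhole one level at a time).  If true it closes the lopsided relative-rank method for
`IMM_{m,⌊√log₂ m⌋}` strictly below the A-cell depth `2·L₃(m)`.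

References: [LimayeSrinivasanTavenas2022] CCC 2022 (LIPIcs 234:32) Def. 2, Thm. 3, Thm. 5, Question 1;
full version ECCC TR22-090 Def. 15, Prop. 16, Prop. 17, Thm. 27; [BhargavDuttaSaxena2024] ACM ToCT 16(4):23
(2024) Thm. 1.4, Thm. 1.7, Rem. 1.8.
-/

-- layout Summits/ValiantsHypothesis/ValiantsHypothesis forces the duplicated namespace component
set_option linter.dupNamespace false

namespace Summit.ValiantsHypothesis.ValiantsHypothesis.Theorems.DepthWindow.TreeBias

open Finset Literature.Computability.AlgebraicComplexity

variable {d : ℕ}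

/-! ### Node bias (LST 2022 full version, Def. 15) and Prop. 17 -/

/-- The **node bias** of the level-`u` node of `T` containing leaf `i` (`u ≥ 1`): the sum of `|Sum(c)|` over
its children `c`, the level-`(u-1)` blocks inside it (LST 2022 full version Def. 15: `Nodebias(T) = max_v
Σ_{children w of v} |Sum(w)|`). [cite: LimayeSrinivasanTavenas2022, Def. 15] -/
def nodeBias (w : Fin d → ℤ) (T : LTree d) (u : ℕ) (i : Fin d) : ℤ :=
  ∑ l ∈ (univ.filter fun j => T.lab u j = T.lab u i).image (T.lab (u - 1)), |blockSum w T (u - 1) l|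

/-- Node bias is nonnegative. [folklore] -/
theorem nodeBias_nonneg (w : Fin d → ℤ) (T : LTree d) (u : ℕ) (i : Fin d) : 0 ≤ nodeBias w T u i :=
  sum_nonneg fun _ _ => abs_nonneg _

/-- Each level of the off-path cost is a sub-sum of that level's node bias, so
`offCost ≤ Σ_{u=t..Δ} nodeBias` (LST 2022 full version, proof of Prop. 17, second inequality).
[cite: LimayeSrinivasanTavenas2022, Prop. 17] -/
theorem offCost_le_sum_nodeBias (w : Fin d → ℤ) (T : LTree d) (Δ t : ℕ) (i : Fin d) :
    offCost w T Δ t i ≤ ∑ u ∈ Icc t Δ, nodeBias w T u i := by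
  unfold offCost nodeBias
  exact sum_le_sum fun u _ =>
    sum_le_sum_of_subset_of_nonneg (filter_subset _ _) fun _ _ _ => abs_nonneg _

/-- The end node of an internal path contributes ALL its children: `nodeBias(v_t) ≤ offCost` (LST 2022 full
version, proof of Prop. 17, first inequality). [cite: LimayeSrinivasanTavenas2022, Prop. 17] -/
theorem nodeBias_le_offCost (w : Fin d → ℤ) (T : LTree d) {Δ t : ℕ} (ht : t ≤ Δ) (i : Fin d) :
    nodeBias w T t i ≤ offCost w T Δ t i := by
  unfold offCost
  have hmem : t ∈ Icc t Δ := mem_Icc.2 ⟨le_rfl, ht⟩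
  refine le_trans (le_of_eq ?_) (single_le_sum (fun u _ => sum_nonneg fun _ _ => abs_nonneg _) hmem)
  unfold nodeBias
  refine sum_congr ?_ fun _ _ => rfl
  exact (filter_true_of_mem fun l _ => Or.inl rfl).symm

/-- **Prop. 17, direction `Nodebias ≤ Treebias + |Sum W|`**, in threshold form: if EVERY depth-`Δ` `W`-tree
has a node (at a level `1 ≤ u ≤ Δ`) of bias `≥ τ + |Sum W|`, then `Treebias_Δ(W) ≥ τ`.
[cite: LimayeSrinivasanTavenas2022, Prop. 17] -/
theorem treeBiasGe_of_nodeBias {w : Fin d → ℤ} {Δ τ : ℕ}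
    (h : ∀ T : LTree d, (∀ i j, T.lab Δ i = T.lab Δ j) →
      ∃ u i, 1 ≤ u ∧ u ≤ Δ ∧ (τ : ℤ) + |∑ j, w j| ≤ nodeBias w T u i) :
    TreeBiasGe w Δ τ := fun T hroot => by
  obtain ⟨u, i, hu1, huΔ, hle⟩ := h T hroot
  exact ⟨u, i, hu1, huΔ, by have := nodeBias_le_offCost w T huΔ i; linarith⟩

/-! ### Low-bias trees and the universal low-bias conjectures -/

/-- `W` admits a depth-`Δ` tree (level `Δ` a single block) all of whose internal nodes, at levels
`1 ≤ u ≤ Δ`, have node bias `≤ β` — the object every relative-rank UPPER bound / formula construction is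
built from (LST 2022 full version §6.2–6.3). [cite: LimayeSrinivasanTavenas2022, Prop. 16, Prop. 17] -/
def LowBiasTree (w : Fin d → ℤ) (Δ : ℕ) (β : ℤ) : Prop :=
  ∃ T : LTree d, (∀ i j, T.lab Δ i = T.lab Δ j) ∧ ∀ u, 1 ≤ u → u ≤ Δ → ∀ i, nodeBias w T u i ≤ β

/-- **Prop. 17, direction `Treebias ≤ Δ·Nodebias`**: one depth-`Δ` tree of node bias `≤ β` everywhere caps
the depth-`Δ` tree bias strictly below any `τ > Δ·β`. [cite: LimayeSrinivasanTavenas2022, Prop. 17] -/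
theorem not_treeBiasGe_of_lowBiasTree {w : Fin d → ℤ} {Δ : ℕ} {β : ℤ} {τ : ℕ}
    (hT : LowBiasTree w Δ β) (hτ : (Δ : ℤ) * β < τ) : ¬ TreeBiasGe w Δ τ := by
  intro hTB
  obtain ⟨T, hroot, hβ⟩ := hT
  obtain ⟨t, i, ht1, htΔ, hτle⟩ := hTB T hroot
  have h1 := offCost_le_sum_nodeBias w T Δ t i
  have h2 : ∑ u ∈ Icc t Δ, nodeBias w T u i ≤ ∑ u ∈ Icc t Δ, β :=
    sum_le_sum fun u hu => hβ u (le_trans ht1 (mem_Icc.1 hu).1) (mem_Icc.1 hu).2 i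
  rw [sum_const, Nat.card_Icc, nsmul_eq_mul] at h2
  have hβ0 : 0 ≤ β := le_trans (nodeBias_nonneg w T t i) (hβ t ht1 htΔ i)
  have h3 : ((Δ + 1 - t : ℕ) : ℤ) * β ≤ (Δ : ℤ) * β :=
    mul_le_mul_of_nonneg_right (by exact_mod_cast (by omega : Δ + 1 - t ≤ Δ)) hβ0
  have h4 : 0 ≤ |∑ j, w j| := abs_nonneg _
  linarith

/-- **Conjecture `ULB_C` (universal low-bias trees at depth slope `C`).**  There are constants `B, c₁` such
that every integer multiset `W = (w_i)_{i<d}` with all letters and the total in `[-h, h]` has a tree of depth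
`C·⌊log₂⌊log₂ d⌋⌋ + c₁` (single block on top) all of whose node biases are `≤ B·h`.  In print: TRUE for
two-letter words from slope `1/log₂ φ ≈ 1.44` on (BDS 2024 Thm. 1.7 `P_Δ`, read through LST 2022 Thm. 3 /
Prop. 16) and expected FALSE at `C = 1` (BDS 2024 Thm. 1.4: golden-ratio words have node bias `d^{μ(Δ)}`,
`μ(Δ) = 1/(F(Δ)-1)`); for general `W` only LST 2022 Thm. 27 (`C_Δ·d^{1/Γ(Δ)}`, never `O(1)`) is known.
`ULB_2` is the workshop's conjecture (NODE-v13, lens 4, g13); OPEN.  By `not_treeBiasGrowthAt_of_ULB` it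
refutes `TreeBiasGrowthAt a` for every `a ≥ C`. [cite: BhargavDuttaSaxena2024, Thm. 1.4, Thm. 1.7]
[cite: LimayeSrinivasanTavenas2022, Thm. 27] -/
@[conjecture] def UniversalLowBiasAt (C : ℕ) : Prop :=
  ∃ B c₁ : ℕ, ∀ (d : ℕ) (w : Fin d → ℤ) (h : ℕ), (∀ i, |w i| ≤ h) → |∑ i, w i| ≤ h →
    LowBiasTree w (C * Nat.log 2 (Nat.log 2 d) + c₁) ((B * h : ℕ) : ℤ)

/-- **Conjecture `ULB` (some slope).**  `∃ C, ULB_C`: universal `O(h)`-node-bias trees at SOME depth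
`O(log₂log₂ d)`.  OPEN (LST 2022 Thm. 27 needs depth `2^{Θ(√(log log d))}` for sub-polynomial node bias); it
already refutes the all-slopes statement `TreeBiasGrowth` (`not_treeBiasGrowth_of_ULB`).
[cite: LimayeSrinivasanTavenas2022, Thm. 27, Question 1] -/
@[conjecture] def UniversalLowBias : Prop := ∃ C : ℕ, UniversalLowBiasAt C

/-! ### The growth statement slope by slope -/

/-- **`TreeBiasGrowthAt a`**: the slope-`a` slice of `TreeBiasGrowth` (same body with `a` fixed): for all
`c C`, eventually in `m`, at every depth `Δ ≤ a·L₃(m) + c + 1` some integer word on `⌊√⌊log₂ m⌋⌋` letters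
fitting `IMM_{m,·}` has depth-`Δ` tree bias `≥ 2·C·(a·L₃(m)+c+2)·⌊log₂ m⌋` bits.  OPEN at every `a ≥ 1`;
refuted by `ULB_C` for `a ≥ C`. [cite: LimayeSrinivasanTavenas2022, Thm. 3, Question 1]
[cite: BhargavDuttaSaxena2024, Thm. 1.7] -/
@[conjecture] def TreeBiasGrowthAt (a : ℕ) : Prop :=
  ∀ c C : ℕ, ∃ m₀ : ℕ, ∀ m : ℕ, m₀ ≤ m →
    ∀ Δ : ℕ, Δ ≤ a * Nat.log 2 (Nat.log 2 (Nat.log 2 m)) + c + 1 →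
      ∃ (sz : Fin (Nat.sqrt (Nat.log 2 m)) → ℕ) (pos : Fin (Nat.sqrt (Nat.log 2 m)) → Bool),
        (∀ i, 1 ≤ sz i) ∧ (∀ t ≤ Nat.sqrt (Nat.log 2 m), 2 ^ GenWord.overLen sz pos t ≤ m) ∧
        TreeBiasGe (GenWord.wt sz pos) Δ
          (2 * (C * (a * Nat.log 2 (Nat.log 2 (Nat.log 2 m)) + c + 2) * Nat.log 2 m))

/-- `TreeBiasGrowth` is the conjunction of its slope slices (definitional). [folklore] -/
theorem treeBiasGrowth_iff : TreeBiasGrowth ↔ ∀ a, TreeBiasGrowthAt a := Iff.rfl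

/-- Tree-bias thresholds are downward closed. [folklore] -/
theorem TreeBiasGe.mono {w : Fin d → ℤ} {Δ τ τ' : ℕ} (h : TreeBiasGe w Δ τ') (hle : τ ≤ τ') :
    TreeBiasGe w Δ τ := fun T hroot => by
  obtain ⟨t, i, h1, h2, h3⟩ := h T hroot
  exact ⟨t, i, h1, h2, le_trans (by exact_mod_cast hle) h3⟩

/-- The slope slices are ANTITONE in the slope: a larger slope asks for more depths and a larger threshold.
[folklore] -/
theorem treeBiasGrowthAt_anti {a a' : ℕ} (haa : a ≤ a') (h : TreeBiasGrowthAt a') : TreeBiasGrowthAt a := by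
  intro c C
  obtain ⟨m₀, hm⟩ := h c C
  refine ⟨m₀, fun m hmm Δ hΔ => ?_⟩
  have hmul := Nat.mul_le_mul_right (Nat.log 2 (Nat.log 2 (Nat.log 2 m))) haa
  obtain ⟨sz, pos, hsz, hfit, hTB⟩ := hm m hmm Δ (le_trans hΔ (by omega))
  refine ⟨sz, pos, hsz, hfit, hTB.mono ?_⟩
  exact Nat.mul_le_mul_left 2 (Nat.mul_le_mul_right _ (Nat.mul_le_mul_left C (by omega)))

/-! ### Letters of fitting words are small -/

/-- Prefix weighted sums step by one letter: `Σ_{j<i+1} w_j = w_i + Σ_{j<i} w_j`. [folklore] -/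
theorem wsum_prefix_succ (sz : Fin d → ℕ) (pos : Fin d → Bool) (i : Fin d) :
    GenWord.wsum sz pos (univ.filter fun j : Fin d => (j : ℕ) < (i : ℕ) + 1) =
      GenWord.wt sz pos i + GenWord.wsum sz pos (univ.filter fun j : Fin d => (j : ℕ) < (i : ℕ)) := by
  unfold GenWord.wsum
  have hsplit : (univ.filter fun j : Fin d => (j : ℕ) < (i : ℕ) + 1) =
      insert i (univ.filter fun j : Fin d => (j : ℕ) < (i : ℕ)) := by
    ext j
    simp only [mem_filter, mem_univ, true_and, mem_insert, Fin.ext_iff]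
    omega
  rw [hsplit, sum_insert (by simp)]

/-- A word fitting in `n` (all prefix overhangs `2^{overLen} ≤ n`) has total `|Σ w_i| ≤ ⌊log₂ n⌋`.
[cite: LimayeSrinivasanTavenas2022, Def. 2] -/
theorem abs_sum_wt_le (sz : Fin d → ℕ) (pos : Fin d → Bool) {n : ℕ}
    (hfit : ∀ t ≤ d, 2 ^ GenWord.overLen sz pos t ≤ n) :
    |∑ i, GenWord.wt sz pos i| ≤ (Nat.log 2 n : ℤ) := by
  have h := Nat.le_log_of_pow_le one_lt_two (hfit d le_rfl)
  rw [GenWord.overLen_eq_natAbs sz pos d le_rfl, filter_true_of_mem (fun j _ => j.isLt)] at h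
  unfold GenWord.wsum at h
  rw [Int.abs_eq_natAbs]
  exact_mod_cast h

/-- A word fitting in `n` has letters `|w_i| ≤ 2·⌊log₂ n⌋` (difference of two consecutive prefix sums).
[cite: LimayeSrinivasanTavenas2022, Def. 2] -/
theorem abs_wt_le (sz : Fin d → ℕ) (pos : Fin d → Bool) {n : ℕ}
    (hfit : ∀ t ≤ d, 2 ^ GenWord.overLen sz pos t ≤ n) (i : Fin d) :
    |GenWord.wt sz pos i| ≤ ((2 * Nat.log 2 n : ℕ) : ℤ) := by
  have h1 := Nat.le_log_of_pow_le one_lt_two (hfit i (le_of_lt i.isLt))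
  have h2 := Nat.le_log_of_pow_le one_lt_two (hfit ((i : ℕ) + 1) (Nat.succ_le_of_lt i.isLt))
  rw [GenWord.overLen_eq_natAbs sz pos i (le_of_lt i.isLt)] at h1
  rw [GenWord.overLen_eq_natAbs sz pos ((i : ℕ) + 1) (Nat.succ_le_of_lt i.isLt), wsum_prefix_succ] at h2
  generalize GenWord.wsum sz pos (univ.filter fun j : Fin d => (j : ℕ) < (i : ℕ)) = P at h1 h2
  have e1 : |P| ≤ (Nat.log 2 n : ℤ) := by rw [Int.abs_eq_natAbs]; exact_mod_cast h1
  have e2 : |GenWord.wt sz pos i + P| ≤ (Nat.log 2 n : ℤ) := by rw [Int.abs_eq_natAbs]; exact_mod_cast h2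
  have e3 : |GenWord.wt sz pos i| ≤ |GenWord.wt sz pos i + P| + |P| := by
    have := abs_sub (GenWord.wt sz pos i + P) P
    simpa using this
  push_cast
  linarith

/-! ### `ULB_C` refutes the growth statement from slope `C` on -/

/-- **`ULB_C ⇒ ¬ TreeBiasGrowthAt a` for `a ≥ C`.**  At `Δ := C·⌊log₂⌊log₂ d⌋⌋ + c₁ ≤ a·L₃(m) + c₁ + 1`
(`d = ⌊√⌊log₂ m⌋⌋ ≤ ⌊log₂ m⌋`) the universal tree has node bias `≤ B·2⌊log₂ m⌋`, so by Prop. 17 the tree bias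
of every fitting word is `≤ Δ·2B·⌊log₂ m⌋ < 2(B+1)(a·L₃+c₁+2)⌊log₂ m⌋`, the threshold with `C₀ := B + 1`.
[cite: LimayeSrinivasanTavenas2022, Prop. 17] [cite: BhargavDuttaSaxena2024, Thm. 1.7] -/
theorem not_treeBiasGrowthAt_of_ULB {C a : ℕ} (hU : UniversalLowBiasAt C) (hCa : C ≤ a) :
    ¬ TreeBiasGrowthAt a := by
  intro hG
  obtain ⟨B, c₁, hB⟩ := hU
  obtain ⟨m₀, hm₀⟩ := hG c₁ (B + 1)
  obtain ⟨m, hmm₀, hm2⟩ : ∃ m, m₀ ≤ m ∧ 2 ≤ m := ⟨max m₀ 2, le_max_left _ _, le_max_right _ _⟩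
  have hL : 1 ≤ Nat.log 2 m := Nat.le_log_of_pow_le one_lt_two (by simpa using hm2)
  have hΔ : C * Nat.log 2 (Nat.log 2 (Nat.sqrt (Nat.log 2 m))) + c₁ ≤
      a * Nat.log 2 (Nat.log 2 (Nat.log 2 m)) + c₁ + 1 := by
    have h2 : Nat.log 2 (Nat.log 2 (Nat.sqrt (Nat.log 2 m))) ≤ Nat.log 2 (Nat.log 2 (Nat.log 2 m)) :=
      Nat.log_mono_right (Nat.log_mono_right (Nat.sqrt_le_self _))
    have h3 := Nat.mul_le_mul hCa h2
    omega
  obtain ⟨sz, pos, _hsz, hfit, hTB⟩ := hm₀ m hmm₀ _ hΔ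
  have hwi : ∀ i, |GenWord.wt sz pos i| ≤ ((2 * Nat.log 2 m : ℕ) : ℤ) := fun i => abs_wt_le sz pos hfit i
  have hws : |∑ i, GenWord.wt sz pos i| ≤ ((2 * Nat.log 2 m : ℕ) : ℤ) :=
    le_trans (abs_sum_wt_le sz pos hfit) (by push_cast; linarith)
  have hT := hB _ (GenWord.wt sz pos) (2 * Nat.log 2 m) hwi hws
  refine not_treeBiasGe_of_lowBiasTree hT ?_ hTB
  generalize Nat.log 2 (Nat.log 2 (Nat.sqrt (Nat.log 2 m))) = Y at hΔ ⊢
  generalize Nat.log 2 (Nat.log 2 (Nat.log 2 m)) = X at hΔ ⊢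
  generalize Nat.log 2 m = L at hL ⊢
  have hΔK : C * Y + c₁ + 1 ≤ a * X + c₁ + 2 := by omega
  have h1 : (C * Y + c₁) * B < (B + 1) * (a * X + c₁ + 2) :=
    calc (C * Y + c₁) * B ≤ (C * Y + c₁) * (B + 1) := Nat.mul_le_mul_left _ (Nat.le_succ B)
      _ < (C * Y + c₁ + 1) * (B + 1) := Nat.mul_lt_mul_of_pos_right (Nat.lt_succ_self _) (Nat.succ_pos B)
      _ ≤ (a * X + c₁ + 2) * (B + 1) := Nat.mul_le_mul_right _ hΔK
      _ = (B + 1) * (a * X + c₁ + 2) := Nat.mul_comm _ _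
  have hnat : (C * Y + c₁) * (B * (2 * L)) < 2 * ((B + 1) * (a * X + c₁ + 2) * L) :=
    calc (C * Y + c₁) * (B * (2 * L)) = ((C * Y + c₁) * B) * (2 * L) := by ring
      _ < ((B + 1) * (a * X + c₁ + 2)) * (2 * L) := Nat.mul_lt_mul_of_pos_right h1 (by omega)
      _ = 2 * ((B + 1) * (a * X + c₁ + 2) * L) := by ring
  exact_mod_cast hnat

/-- **`ULB ⇒ ¬ TreeBiasGrowth`**: universal `O(h)`-node-bias trees at ANY slope `O(log log d)` refute the
all-slopes growth statement of `DepthWindowTreeBiasBridge`. [cite: LimayeSrinivasanTavenas2022, Prop. 17] -/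
theorem not_treeBiasGrowth_of_ULB (hU : UniversalLowBias) : ¬ TreeBiasGrowth := fun hG => by
  obtain ⟨C, hC⟩ := hU
  exact not_treeBiasGrowthAt_of_ULB hC le_rfl (hG C)

/-- Contrapositive bookkeeping: a witness of `TreeBiasGrowthAt a` refutes `ULB_C` for every `C ≤ a` — any
word family certifying the A-cell through the tree-bias door is a counterexample to universal low-bias trees
at slope `≤ a`. [folklore] -/
theorem not_ULB_of_treeBiasGrowthAt {C a : ℕ} (hCa : C ≤ a) (hG : TreeBiasGrowthAt a) :
    ¬ UniversalLowBiasAt C := fun hU => not_treeBiasGrowthAt_of_ULB hU hCa hG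

end Summit.ValiantsHypothesis.ValiantsHypothesis.Theorems.DepthWindow.TreeBias
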